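import Summits.QuantumFields.BalabanUV.Beta.D1BFx.RoadEndBFxTotalShellS
import Summits.QuantumFields.BalabanUV.Beta.D1BFx.RoadEndBFxTotalMeanShell

/-!
# `BalabanUV.Beta.D1BFx.RoadEndBFxTotalMeanShellS` — road «BF-x» for binder row D1: THE TOTAL-REST MEAN-GRADING END IN SHELL CURRENCY OVER THE TWO-PROFILE
# RE-CUT TABLE, variant «ENDₛ» (END-ii-SPEC v1.2 §6 backlog, MEAN lane link 3 — the `JsRowD1Pin` consumer the an2 spine meets): gan24-leaf-05's
# `RoadEndBFxTotalMeanShell` (§1 ANY `Js` with `hall`∕`hθ0`∕`hθ1` + B1_mean; §2 d0∕d1 + (α)-leaf from the printed statements; §3 `JsRowD1Pin` from its slots) with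
# `(hω) ↦ (s)(hωs)` and the rest total over `restKS n a (gfrz n a b) (s n • gfrz n a b)`

HONEST DEPENDENCY (page 1, mandatory): continuum YM on T⁴ ⇐ BetaPertH ∧ nine spine estimates (0/9 proved); BetaPertH ⇐ (D1) ∧ (D4) ∧
CAP+tail; G-an2-4 gates asym, D1 and NE2/3/4.  HONEST FRAMING (cell contract, verbatim): «discharging `BetaPertH` makes Bałaban's UV
stability UNCONDITIONAL — a real constructive-QFT result; it is NOT the continuum limit and NOT the Clay problem.»  THIS MODULE DISCHARGES
NOTHING of the wall: [folklore] re-wiring BY NAME of `AssemblyEndTotalS.defect_le_at_totalS` + `RoadEndBFxTotalShellS.rest_corner_recutS` through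
`RoadEndBFxRecutMean.hT_mean_of_pointwise` over `ShellRoadEndMean.d1Drift_of_meanRoad_table_shell`, then `FrozenLegTails.far_rows_d0_d1_of_prop12` ∕
`GluonLegTails.hGa_of_prop12` (CONDITIONAL on `h12`∕`h126` BY NAME) and `RoadEndRowPinned.exists_allScalesSeq_JsRowD1Pin_of_slots`.  No `def`, nothing cited, 0 sorry.
DISPLAYED DEBT OF THE MEAN LANE AFTER THIS FILE, BY NAME: the four (E)-rows (or their slots `hS`∕`hSall`∕`hW`∕`hWall` + radii ∕ rates for `JsRowD1Pin`); B1_mean; (K) `hK` + `hωs` +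
`hlam`; the five slot-table sockets; `hdiv`; `hrowgh`; shell rows h2s∕d2s; `hRestTot` over the two-profile words; (U); `h12`∕`h126`.  0 wall binders (hW ∕ hR-sockets ∕
hSX-socket ∕ D1Tel ∕ D1Rep = 0); NOT (K), NOT D1, NOT `BetaPertH`, NOT continuum, NOT Clay.

ABSOLUTE RULE (cell charter, verbatim): «No internally-minted statement may enter as a cited fact. Every hypothesis is either kernel-proved in
this package or a verbatim quotation of a PUBLISHED theorem with page reference. The manuscript(s) under audit are NOT citable for their own
disputed steps — they are the thing under adjudication; programme-internal (2001/route/tribunal) claims are never citable.»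

CONTENT.
* §1 **`d1Drift_BFx_total_mean_shellS`**.  §2 **`d1Drift_BFx_total_mean_shell_of_prop12S`**.  §3 **`d1Drift_BFx_total_mean_shell_JsRowD1Pin_of_prop12_of_slotsS`**.
Unit `b2b-balaban-beta-d1-p2` (road owner, gen 12); `LEAVES-BFx.md` row A7-ENDₛ (mean lane); END-ii-SPEC v1.2 §6.
-/

noncomputable section

open Finset Filter Topology
open Literature.Probability.LatticeModels (annulus)
open scoped BigOperators
open Literature.MathematicalPhysics.QuantumFieldTheory
open Literature.MathematicalPhysics.QuantumFieldTheory.Balaban1983to89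
open Literature.MathematicalPhysics.QuantumFieldTheory.Balaban1983to89.Beta
open RemainderConstAllScales (AllScalesSeq)
open OneStepResolventKernel (JetData LocStencil)
open OneStepKernelFamily (TbalOf D1Drift)
open WindowIdentification (fullSum)
open DyadicShell (Pt supNorm)
open ExpKernelCalculus (Site BiLoc VertexFamily₂ shiftK)
open AffineAveraging (toSite)
open AveragingContoursRooted (ctrOff)
open AveragingMixedJetTables (mixFFAt)
open WilsonVertex2Sym (wsym22)
open SquareTable (stK)
open GhostTable (gFree)
open BubbleTransfer (unitVec)
open DressedMomentNormalisation (resSite)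
open Summit.QuantumFields.BalabanUV.Beta.TameKernelCalculus (Spr)
open Summit.QuantumFields.BalabanUV.Beta.HessKerDressedUnits (unitS unitW)
open Summit.QuantumFields.BalabanUV.Beta.GAN24.CombesThomas (sfStep smStep)
open Summit.QuantumFields.BalabanUV.Beta.SpineRooted (WrecAt)
open Summit.QuantumFields.BalabanUV.Beta.WardLocusRecursive (SrecAt)
open Summit.QuantumFields.BalabanUV.Beta.SecondOrderSocketIdentification (vh₂SAn1)
open Summit.QuantumFields.BalabanUV.Beta.RowD1JointEnd (JsRowD1Pin)
open Summit.QuantumFields.BalabanUV.Beta.D1BFx.GluonLeg (Ga)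
open Summit.QuantumFields.BalabanUV.Beta.D1BFx.ReducedKernel (TableR TOfRed)
open Summit.QuantumFields.BalabanUV.Beta.D1BFx.DressedTadpoleTable (tableRed)
open Summit.QuantumFields.BalabanUV.Beta.D1BFx.ReducedKernelSandwich (fineHess)
open Summit.QuantumFields.BalabanUV.Beta.D1BFx.FineStencilBFBalaban (SbfBal)
open Summit.QuantumFields.BalabanUV.Beta.D1BFx.SecondStencilBF (Wbf)
open Summit.QuantumFields.BalabanUV.Beta.D1BFx.GhostKernelComplete (PghQ fineHessGhQ)
open Summit.QuantumFields.BalabanUV.Beta.D1BFx.FrozenLegProfile (gfrz gfrz_neg decay_gfrz abs_gfrz_sub_gFree_le abs_gfrz_diff_flat_le)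
open Summit.QuantumFields.BalabanUV.Beta.D1BFx.SplitInstance (RestIdx)
open Summit.QuantumFields.BalabanUV.Beta.D1BFx.SplitInstanceS (restKS)
open Summit.QuantumFields.BalabanUV.Beta.D1BFx.Assembly (sum_uniform_resSite)
open Summit.QuantumFields.BalabanUV.Beta.D1BFx.RoadEndBFxRecut (cornerIdx rowConst gfrz₀ gfrz₀_eq rowConst_nonneg)
open Summit.QuantumFields.BalabanUV.Beta.D1BFx.AssemblyEndTotalS (defect_le_at_totalS)
open Summit.QuantumFields.BalabanUV.Beta.D1BFx.RoadEndBFxTotalShellS (rest_corner_recutS)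
open Summit.QuantumFields.BalabanUV.Beta.D1BFx.RoadEndBFxRecutMean (hT_mean_of_pointwise)
open Summit.QuantumFields.BalabanUV.Beta.D1BFx.ShellRoadEndMean (d1Drift_of_meanRoad_table_shell)
open Summit.QuantumFields.BalabanUV.Beta.D1BFx.FrozenLegTails (nOf MOf hn1 far_rows_d0_d1_of_prop12)
open Summit.QuantumFields.BalabanUV.Beta.D1BFx.GluonLegTails (hGa_of_prop12)
open Summit.QuantumFields.BalabanUV.Beta.D1BFx.RoadEndBFxRecutTails (tailConst tailConst_nonneg)
open Summit.QuantumFields.BalabanUV.Beta.D1BFx.RoadEndRowPinned (exists_allScalesSeq_JsRowD1Pin_of_slots)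
open VectorTailsLoc (fam kfam)

namespace Summit.QuantumFields.BalabanUV.Beta.D1BFx.RoadEndBFxTotalMeanShellS

variable {Lc : ℕ} [NeZero Lc] {a N : ℝ} {μ ν : Fin 4} {υ : Type*} [Fintype υ]
  {cE cVH cΛ cR cK cQ cE₂ cJ4 cΛ₂ cR₂ cQ₂ x₀ ωgl ωgh : ℕ → ℝ} {WE WJ WΛ WR WQ : ℕ → TableR} {CE CJ CΛ CRt CQ δW : ℕ → ℝ}
  {Ru : υ → ℕ → ℝ} {CU : υ → ℝ} {CRtot : ℝ} {A : ℕ → ℝ} {D₂ δ κ θ : ℝ}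

/-! ## §1 The MEAN-grading twin of the total-rest END in shell currency, any jet data under a displayed all-scales bound -/

/-- [folklore] **«ENDₛ» VARIANT** (rescaled tie `hωs` with a displayed family `s`; rest words `restKS (gfrz n a b) (s n • gfrz n a b)`; `s ≡ 1` = the record, `s n = n⁻²` = END-ii) of the record's theorem of the same name without the `S`: **ROAD BF-x, MEAN GRADING, TOTAL-REST FORM, SHELL FAR ROWS — ANY JET DATA `Js` UNDER A DISPLAYED ALL-SCALES BOUND** (`Odd Lc`, `2 ≤ Lc`):
`hall`∕`hθ0`∕`hθ1` on the step coefficients `β⁰_j := secondMoment (TbalOf Lc Js j) μ ν` (row G-an2-4; a theorem only for the superseded Π_root literal), bridge B1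
in CESÀRO form `((Σ_{j<m} β⁰_j) − c (Lc^m))∕m → 0`, and — verbatim from the owner's `RoadEndBFxTotal.d1Drift_BFx_total` ∕ this lineage's
`RoadEndBFxTotalShell.d1Drift_BFx_total_shell` — (K) `hK`+`hω`+`hlam`, `Spr (Ga n a)`, the five slot-table sockets, `hdiv`, `hrowgh`, the far rows of `gfrz` (h2s∕d2s
SHELL, d0∕d1 pointwise), `hRestTot`, (U) ⟹ `D1Drift Lc Js N μ ν`.  The table-side mean target is DERIVED from the owner's pointwise total-rest defect bound
(`AssemblyEndTotal.defect_le_at_total` + `rest_corner_recut`) through `RoadEndBFxRecutMean.hT_mean_of_pointwise`. -/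
theorem d1Drift_BFx_total_mean_shellS (Js : ℕ → JetData 3 Lc) (hμν : μ ≠ ν) (hN : N ≠ 0) (hL : 2 ≤ Lc) (hodd : Odd Lc) (ha : 0 < a) (c : ℕ → ℝ)
    (hD₂ : 0 ≤ D₂) (hA : ∀ j, 0 ≤ A j) (hδ : 0 < δ)
    -- the all-scales bound of the step coefficients of `Js` (row G-an2-4)
    (hall : AllScalesSeq (fun j => B12Beta.secondMoment (TbalOf Lc Js j) μ ν) κ θ) (hθ0 : 0 ≤ θ) (hθ1 : θ < 1)
    -- the frozen profile's far rows: h2s∕d2s in SHELL currency, d0∕d1 pointwise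
    (h2s : ∀ n : ℕ, 2 ≤ n → ∀ [NeZero n], ∀ b ∈ (univ : Finset (Fin 4 → Fin n)).image resSite, ∀ r : ℕ, r + 1 ≤ n →
      ∑ v ∈ annulus 4 r (r + 1), |(gfrz n a b (v + unitVec ν + unitVec μ) - gFree (v + unitVec ν + unitVec μ)) -
          (gfrz n a b (v + unitVec ν) - gFree (v + unitVec ν)) - (gfrz n a b (v + unitVec μ) - gFree (v + unitVec μ)) +
          (gfrz n a b v - gFree v)| ≤ D₂ / (n : ℝ))
    (d0 : ∀ n : ℕ, 2 ≤ n → ∀ [NeZero n], ∀ b ∈ (univ : Finset (Fin 4 → Fin n)).image resSite, ∀ v : Pt, v ≠ 0 →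
      |gfrz n a b v| ≤ A 0 * Real.exp (-(δ / n) * supNorm v) / (supNorm v : ℝ) ^ 2)
    (d1 : ∀ n : ℕ, 2 ≤ n → ∀ [NeZero n], ∀ b ∈ (univ : Finset (Fin 4 → Fin n)).image resSite, ∀ v : Pt, v ≠ 0 → ∀ ρ : Fin 4,
      |gfrz n a b (v + unitVec ρ) - gfrz n a b v| ≤ A 1 * Real.exp (-(δ / n) * supNorm v) / (supNorm v : ℝ) ^ 3)
    (d2s : ∀ n : ℕ, 2 ≤ n → ∀ [NeZero n], ∀ b ∈ (univ : Finset (Fin 4 → Fin n)).image resSite, ∀ r : ℕ, n ≤ r →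
      ∑ v ∈ annulus 4 r (r + 1), |gfrz n a b (v + unitVec ν + unitVec μ) - gfrz n a b (v + unitVec ν) - gfrz n a b (v + unitVec μ) + gfrz n a b v| ≤
        A 2 * Real.exp (-(δ / n) * ((r : ℝ) + 1)) / ((r : ℝ) + 1))
    -- bridge B1 in MEAN (Cesàro) form
    (hB1 : Tendsto (fun m : ℕ => ((∑ j ∈ range m, B12Beta.secondMoment (TbalOf Lc Js j) μ ν) - c (Lc ^ m)) / (m : ℝ)) atTop (𝓝 0))
    -- the (α)-leaf and slot (K) with the loop-weight ratio and the PINNED normalisation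
    (hGa : ∀ n : ℕ, 2 ≤ n → ∀ [NeZero n], Spr (Ga n a))
    (hK : ∀ n : ℕ, 2 ≤ n → Odd n → ∀ [NeZero n], c n =
      ωgl n * B12Beta.secondMoment (TOfRed n a (SbfBal n a (cE n) (cVH n) (cΛ n) (cR n) (cK n) (cQ n))
        (tableRed n (Wbf (cE₂ n) (cJ4 n) (cΛ₂ n) (cR₂ n) (cQ₂ n) (WE n) (WJ n) (WΛ n) (WR n) (WQ n)))) μ ν
      + ωgh n * B12Beta.secondMoment (PghQ n a (x₀ n) (cK n) (cQ n)) μ ν + ∑ u, Ru u n)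
    (s : ℕ → ℝ) (hωs : ∀ n : ℕ, 2 ≤ n → ωgh n * (s n * cK n) ^ 2 = -2 * (ωgl n * cE n ^ 2))
    (hlam : ∀ n : ℕ, 2 ≤ n → ωgl n * cE n ^ 2 = 2 * N ^ 2 * (n : ℝ) ^ 8)
    -- slot-table sockets
    (hδW : ∀ n, 0 < δW n)
    (hE : ∀ n κ u l u', BiLoc (WE n κ u l u') u u' (CE n) (δW n)) (hJ : ∀ n κ u l u', BiLoc (WJ n κ u l u') u u' (CJ n) (δW n))
    (hΛ : ∀ n κ u l u', BiLoc (WΛ n κ u l u') u u' (CΛ n) (δW n)) (hR : ∀ n κ u l u', BiLoc (WR n κ u l u') u u' (CRt n) (δW n))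
    (hQ : ∀ n κ u l u', BiLoc (WQ n κ u l u') u u' (CQ n) (δW n))
    (hEc : ∀ (n : ℕ) (κ : Fin 4) (u : Site 4) (l : Fin 4) (u' t : Site 4),
      WE n κ (u + (n : ℤ) • t) l (u' + (n : ℤ) • t) = shiftK (-((n : ℤ) • t)) (WE n κ u l u'))
    (hJc : ∀ (n : ℕ) (κ : Fin 4) (u : Site 4) (l : Fin 4) (u' t : Site 4),
      WJ n κ (u + (n : ℤ) • t) l (u' + (n : ℤ) • t) = shiftK (-((n : ℤ) • t)) (WJ n κ u l u'))
    (hΛc : ∀ (n : ℕ) (κ : Fin 4) (u : Site 4) (l : Fin 4) (u' t : Site 4),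
      WΛ n κ (u + (n : ℤ) • t) l (u' + (n : ℤ) • t) = shiftK (-((n : ℤ) • t)) (WΛ n κ u l u'))
    (hRc : ∀ (n : ℕ) (κ : Fin 4) (u : Site 4) (l : Fin 4) (u' t : Site 4),
      WR n κ (u + (n : ℤ) • t) l (u' + (n : ℤ) • t) = shiftK (-((n : ℤ) • t)) (WR n κ u l u'))
    (hQc : ∀ (n : ℕ) (κ : Fin 4) (u : Site 4) (l : Fin 4) (u' t : Site 4),
      WQ n κ (u + (n : ℤ) • t) l (u' + (n : ℤ) • t) = shiftK (-((n : ℤ) • t)) (WQ n κ u l u'))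
    (hEs : ∀ n κ u l u', WE n κ u l u' = WE n l u' κ u) (hJs : ∀ n κ u l u', WJ n κ u l u' = WJ n l u' κ u)
    (hΛs : ∀ n κ u l u', WΛ n κ u l u' = WΛ n l u' κ u) (hRs : ∀ n κ u l u', WR n κ u l u' = WR n l u' κ u)
    (hQs : ∀ n κ u l u', WQ n κ u l u' = WQ n l u' κ u)
    -- first-bond divergence-freeness of the gluon fine Hessian kernel; the ghost Ward rows
    (hdiv : ∀ n : ℕ, 2 ≤ n → ∀ [NeZero n], ∀ (l' : Fin 4) (u' u : Site 4), ∑ κ' : Fin 4,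
      (fineHess n a (SbfBal n a (cE n) (cVH n) (cΛ n) (cR n) (cK n) (cQ n))
          (Wbf (cE₂ n) (cJ4 n) (cΛ₂ n) (cR₂ n) (cQ₂ n) (WE n) (WJ n) (WΛ n) (WR n) (WQ n)) κ' l' (u - Pi.single κ' 1) u'
        - fineHess n a (SbfBal n a (cE n) (cVH n) (cΛ n) (cR n) (cK n) (cQ n))
          (Wbf (cE₂ n) (cJ4 n) (cΛ₂ n) (cR₂ n) (cQ₂ n) (WE n) (WJ n) (WΛ n) (WR n) (WQ n)) κ' l' u u') = 0)
    (hrowgh : ∀ n : ℕ, 2 ≤ n → ∀ [NeZero n], ∀ (κ' l' : Fin 4) (b : Site 4), HasSum (fineHessGhQ n a (x₀ n) (cK n) (cQ n) κ' l' b) 0)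
    -- (REST-TOTAL); (U)
    (hRestTot : ∀ n : ℕ, 2 ≤ n → ∀ [NeZero n],
      |∑ b ∈ (univ : Finset (Fin 4 → Fin n)).image resSite, ((n : ℝ) ^ 4)⁻¹ *
        fullSum (fun w : Pt => ∑ τ ∈ (univ : Finset RestIdx).erase cornerIdx,
          restKS n a (gfrz n a b) (fun v => s n * gfrz n a b v) (cE n) (cΛ n) (cR n) (cK n) (cQ n) (cE₂ n) (cJ4 n) (cΛ₂ n) (cR₂ n) (cQ₂ n) (x₀ n)
            (WE n) (WJ n) (WΛ n) (WR n) (WQ n) (ωgl n) (ωgh n) ((n : ℝ) ^ 8) N μ ν b τ w)| ≤ CRtot)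
    (hU : ∀ n : ℕ, 2 ≤ n → ∀ u, |Ru u n| ≤ CU u) :
    D1Drift Lc Js N μ ν := by
  refine d1Drift_of_meanRoad_table_shell Js hμν hN hL hall hθ0 hθ1 c (Bset := fun n => (univ : Finset (Fin 4 → Fin n)).image resSite)
    (wt := fun n _ => ((n : ℝ) ^ 4)⁻¹) (Gf := gfrz₀ a) (D := rowConst a D₂) (A := A) (δ := δ)
    (rowConst_nonneg ha hD₂) hA hδ (fun n _ _ _ => by positivity) (fun n hn => sum_uniform_resSite (by omega)) ?_ ?_ ?_ ?_ ?_ ?_ hB1 ?_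
  · intro n hn b _ v
    haveI : NeZero n := ⟨by omega⟩
    rw [gfrz₀_eq a n]
    exact abs_gfrz_sub_gFree_le n (le_trans one_le_two hn) ha b v
  · intro n hn b _ v ρ
    haveI : NeZero n := ⟨by omega⟩
    rw [gfrz₀_eq a n]
    exact abs_gfrz_diff_flat_le n (le_trans one_le_two hn) ha b v ρ
  · intro n hn b hb r hr
    haveI : NeZero n := ⟨by omega⟩
    rw [gfrz₀_eq a n]
    exact h2s n hn b hb r hr
  · intro n hn b hb v hv
    haveI : NeZero n := ⟨by omega⟩
    rw [gfrz₀_eq a n]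
    exact d0 n hn b hb v hv
  · intro n hn b hb v hv ρ
    haveI : NeZero n := ⟨by omega⟩
    rw [gfrz₀_eq a n]
    exact d1 n hn b hb v hv ρ
  · intro n hn b hb r hr
    haveI : NeZero n := ⟨by omega⟩
    rw [gfrz₀_eq a n]
    exact d2s n hn b hb r hr
  -- the mean target from the owner's pointwise total-rest defect bound
  refine hT_mean_of_pointwise (c := c)
    (F := fun n => ∑ b ∈ (univ : Finset (Fin 4 → Fin n)).image resSite, ((n : ℝ) ^ 4)⁻¹ * fullSum (stK μ ν N (gfrz₀ a n b)))
    (U := (∑ u, CU u) + (0 + CRtot)) (fun n hn hon => ?_) hL hodd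
  haveI : NeZero n := ⟨by omega⟩
  rw [gfrz₀_eq a n]
  exact defect_le_at_totalS n a (cE n) (cVH n) (cΛ n) (cR n) (cK n) (cQ n) (cE₂ n) (cJ4 n) (cΛ₂ n) (cR₂ n) (cQ₂ n) (x₀ n) (ωgl n) (ωgh n)
    ((n : ℝ) ^ 8) N (gp := gfrz n a) hn hon ha hμν (hGa n hn) (hK n hn hon) (s n) (hωs n hn) (hlam n hn) (hδW n) (hE n) (hJ n) (hΛ n) (hR n)
    (hQ n) (hEc n) (hJc n) (hΛc n) (hRc n) (hQc n) (hEs n) (hJs n) (hΛs n) (hRs n) (hQs n) (hdiv n hn) (hrowgh n hn)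
    (fun b => decay_gfrz (hGa n hn) b) (fun b w => gfrz_neg w)
    (rest_corner_recutS n a (cE n) (cΛ n) (cR n) (cK n) (cQ n) (cE₂ n) (cJ4 n) (cΛ₂ n) (cR₂ n) (cQ₂ n) (x₀ n) (ωgl n) (ωgh n) N
      (WE n) (WJ n) (WΛ n) (WR n) (WQ n) hμν (hGa n hn) (fun b v => s n * gfrz n a b v)) (hRestTot n hn) (hU n hn)

/-! ## §2 … with d0∕d1 and the (α)-leaf from the printed statements -/

/-- [folklore] **«ENDₛ» VARIANT** (rescaled tie `hωs` with a displayed family `s`; rest words `restKS (gfrz n a b) (s n • gfrz n a b)`; `s ≡ 1` = the record, `s n = n⁻²` = END-ii) of the record's theorem of the same name without the `S`: **THE MEAN-GRADING DEBT END (total-rest form, shell currency) WITH d0∕d1 AND `Spr (Ga n a)` FROM [B5, Prop. 1.2] ∧ [B5, (1.126)–(1.127)] BY NAME**,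
any `Js` under a displayed all-scales bound: §1 with the rows d0∕d1 supplied by `FrozenLegTails.far_rows_d0_d1_of_prop12` and `hGa` by `GluonLegTails.hGa_of_prop12`
from the two printed statements `h12`∕`h126` (hypotheses, NOT proved here); END run at `δ := min δ₁ δ₂`. -/
theorem d1Drift_BFx_total_mean_shell_of_prop12S (Js : ℕ → JetData 3 Lc) (hμν : μ ≠ ν) (hN : N ≠ 0) (hL : 2 ≤ Lc) (hodd : Odd Lc) (ha : 0 < a)
    (c : ℕ → ℝ) {A₂ δ₂ : ℝ} (hD₂ : 0 ≤ D₂) (hA₂ : 0 ≤ A₂) (hδ₂ : 0 < δ₂)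
    (hall : AllScalesSeq (fun j => B12Beta.secondMoment (TbalOf Lc Js j) μ ν) κ θ) (hθ0 : 0 ≤ θ) (hθ1 : θ < 1)
    (h12 : B5.Prop12Printed (fam nOf hn1 MOf a ha)) (h126 : B5.Kernel126_127Printed (kfam nOf MOf))
    (h2s : ∀ n : ℕ, 2 ≤ n → ∀ [NeZero n], ∀ b ∈ (univ : Finset (Fin 4 → Fin n)).image resSite, ∀ r : ℕ, r + 1 ≤ n →
      ∑ v ∈ annulus 4 r (r + 1), |(gfrz n a b (v + unitVec ν + unitVec μ) - gFree (v + unitVec ν + unitVec μ)) -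
          (gfrz n a b (v + unitVec ν) - gFree (v + unitVec ν)) - (gfrz n a b (v + unitVec μ) - gFree (v + unitVec μ)) +
          (gfrz n a b v - gFree v)| ≤ D₂ / (n : ℝ))
    (d2s : ∀ n : ℕ, 2 ≤ n → ∀ [NeZero n], ∀ b ∈ (univ : Finset (Fin 4 → Fin n)).image resSite, ∀ r : ℕ, n ≤ r →
      ∑ v ∈ annulus 4 r (r + 1), |gfrz n a b (v + unitVec ν + unitVec μ) - gfrz n a b (v + unitVec ν) - gfrz n a b (v + unitVec μ) + gfrz n a b v| ≤
        A₂ * Real.exp (-(δ₂ / n) * ((r : ℝ) + 1)) / ((r : ℝ) + 1))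
    (hB1 : Tendsto (fun m : ℕ => ((∑ j ∈ range m, B12Beta.secondMoment (TbalOf Lc Js j) μ ν) - c (Lc ^ m)) / (m : ℝ)) atTop (𝓝 0))
    (hK : ∀ n : ℕ, 2 ≤ n → Odd n → ∀ [NeZero n], c n =
      ωgl n * B12Beta.secondMoment (TOfRed n a (SbfBal n a (cE n) (cVH n) (cΛ n) (cR n) (cK n) (cQ n))
        (tableRed n (Wbf (cE₂ n) (cJ4 n) (cΛ₂ n) (cR₂ n) (cQ₂ n) (WE n) (WJ n) (WΛ n) (WR n) (WQ n)))) μ ν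
      + ωgh n * B12Beta.secondMoment (PghQ n a (x₀ n) (cK n) (cQ n)) μ ν + ∑ u, Ru u n)
    (s : ℕ → ℝ) (hωs : ∀ n : ℕ, 2 ≤ n → ωgh n * (s n * cK n) ^ 2 = -2 * (ωgl n * cE n ^ 2))
    (hlam : ∀ n : ℕ, 2 ≤ n → ωgl n * cE n ^ 2 = 2 * N ^ 2 * (n : ℝ) ^ 8)
    (hδW : ∀ n, 0 < δW n)
    (hE : ∀ n κ u l u', BiLoc (WE n κ u l u') u u' (CE n) (δW n)) (hJ : ∀ n κ u l u', BiLoc (WJ n κ u l u') u u' (CJ n) (δW n))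
    (hΛ : ∀ n κ u l u', BiLoc (WΛ n κ u l u') u u' (CΛ n) (δW n)) (hR : ∀ n κ u l u', BiLoc (WR n κ u l u') u u' (CRt n) (δW n))
    (hQ : ∀ n κ u l u', BiLoc (WQ n κ u l u') u u' (CQ n) (δW n))
    (hEc : ∀ (n : ℕ) (κ : Fin 4) (u : Site 4) (l : Fin 4) (u' t : Site 4),
      WE n κ (u + (n : ℤ) • t) l (u' + (n : ℤ) • t) = shiftK (-((n : ℤ) • t)) (WE n κ u l u'))
    (hJc : ∀ (n : ℕ) (κ : Fin 4) (u : Site 4) (l : Fin 4) (u' t : Site 4),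
      WJ n κ (u + (n : ℤ) • t) l (u' + (n : ℤ) • t) = shiftK (-((n : ℤ) • t)) (WJ n κ u l u'))
    (hΛc : ∀ (n : ℕ) (κ : Fin 4) (u : Site 4) (l : Fin 4) (u' t : Site 4),
      WΛ n κ (u + (n : ℤ) • t) l (u' + (n : ℤ) • t) = shiftK (-((n : ℤ) • t)) (WΛ n κ u l u'))
    (hRc : ∀ (n : ℕ) (κ : Fin 4) (u : Site 4) (l : Fin 4) (u' t : Site 4),
      WR n κ (u + (n : ℤ) • t) l (u' + (n : ℤ) • t) = shiftK (-((n : ℤ) • t)) (WR n κ u l u'))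
    (hQc : ∀ (n : ℕ) (κ : Fin 4) (u : Site 4) (l : Fin 4) (u' t : Site 4),
      WQ n κ (u + (n : ℤ) • t) l (u' + (n : ℤ) • t) = shiftK (-((n : ℤ) • t)) (WQ n κ u l u'))
    (hEs : ∀ n κ u l u', WE n κ u l u' = WE n l u' κ u) (hJs : ∀ n κ u l u', WJ n κ u l u' = WJ n l u' κ u)
    (hΛs : ∀ n κ u l u', WΛ n κ u l u' = WΛ n l u' κ u) (hRs : ∀ n κ u l u', WR n κ u l u' = WR n l u' κ u)
    (hQs : ∀ n κ u l u', WQ n κ u l u' = WQ n l u' κ u)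
    (hdiv : ∀ n : ℕ, 2 ≤ n → ∀ [NeZero n], ∀ (l' : Fin 4) (u' u : Site 4), ∑ κ' : Fin 4,
      (fineHess n a (SbfBal n a (cE n) (cVH n) (cΛ n) (cR n) (cK n) (cQ n))
          (Wbf (cE₂ n) (cJ4 n) (cΛ₂ n) (cR₂ n) (cQ₂ n) (WE n) (WJ n) (WΛ n) (WR n) (WQ n)) κ' l' (u - Pi.single κ' 1) u'
        - fineHess n a (SbfBal n a (cE n) (cVH n) (cΛ n) (cR n) (cK n) (cQ n))
          (Wbf (cE₂ n) (cJ4 n) (cΛ₂ n) (cR₂ n) (cQ₂ n) (WE n) (WJ n) (WΛ n) (WR n) (WQ n)) κ' l' u u') = 0)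
    (hrowgh : ∀ n : ℕ, 2 ≤ n → ∀ [NeZero n], ∀ (κ' l' : Fin 4) (b : Site 4), HasSum (fineHessGhQ n a (x₀ n) (cK n) (cQ n) κ' l' b) 0)
    (hRestTot : ∀ n : ℕ, 2 ≤ n → ∀ [NeZero n],
      |∑ b ∈ (univ : Finset (Fin 4 → Fin n)).image resSite, ((n : ℝ) ^ 4)⁻¹ *
        fullSum (fun w : Pt => ∑ τ ∈ (univ : Finset RestIdx).erase cornerIdx,
          restKS n a (gfrz n a b) (fun v => s n * gfrz n a b v) (cE n) (cΛ n) (cR n) (cK n) (cQ n) (cE₂ n) (cJ4 n) (cΛ₂ n) (cR₂ n) (cQ₂ n) (x₀ n)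
            (WE n) (WJ n) (WΛ n) (WR n) (WQ n) (ωgl n) (ωgh n) ((n : ℝ) ^ 8) N μ ν b τ w)| ≤ CRtot)
    (hU : ∀ n : ℕ, 2 ≤ n → ∀ u, |Ru u n| ≤ CU u) :
    D1Drift Lc Js N μ ν := by
  obtain ⟨δ₁, A₀, A₁, hδ₁, hA₀, hA₁, hd0, hd1⟩ := far_rows_d0_d1_of_prop12 ha h12 h126
  have hδ : 0 < min δ₁ δ₂ := lt_min hδ₁ hδ₂
  refine d1Drift_BFx_total_mean_shellS (A := tailConst A₀ A₁ A₂) (δ := min δ₁ δ₂) Js hμν hN hL hodd ha c hD₂ (tailConst_nonneg hA₀ hA₁ hA₂) hδ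
    hall hθ0 hθ1 h2s ?_ ?_ ?_ hB1 (hGa_of_prop12 ha h12 h126) hK s hωs hlam hδW hE hJ hΛ hR hQ hEc hJc hΛc hRc hQc hEs hJs hΛs hRs hQs hdiv hrowgh
    hRestTot hU
  · intro n hn _ b hb v hv
    refine (hd0 n hn b hb v hv).trans ?_
    show A₀ * Real.exp (-(δ₁ / n) * supNorm v) / (supNorm v : ℝ) ^ 2 ≤ A₀ * Real.exp (-(min δ₁ δ₂ / n) * supNorm v) / (supNorm v : ℝ) ^ 2
    gcongr
    exact min_le_left _ _
  · intro n hn _ b hb v hv ρ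
    refine (hd1 n hn b hb v hv ρ).trans ?_
    show A₁ * Real.exp (-(δ₁ / n) * supNorm v) / (supNorm v : ℝ) ^ 3 ≤ A₁ * Real.exp (-(min δ₁ δ₂ / n) * supNorm v) / (supNorm v : ℝ) ^ 3
    gcongr
    exact min_le_left _ _
  · intro n hn _ b hb r hr
    refine (d2s n hn b hb r hr).trans ?_
    show A₂ * Real.exp (-(δ₂ / n) * ((r : ℝ) + 1)) / ((r : ℝ) + 1) ≤
      A₂ * Real.exp (-(min δ₁ δ₂ / n) * ((r : ℝ) + 1)) / ((r : ℝ) + 1)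
    gcongr
    exact min_le_right _ _

/-! ## §3 The MEAN-grading debt END AT THE LITERAL OF RECORD on the (E)-family S-∕W-slot socket -/

/-- [folklore] **«ENDₛ» VARIANT** (rescaled tie `hωs` with a displayed family `s`; rest words `restKS (gfrz n a b) (s n • gfrz n a b)`; `s ≡ 1` = the record, `s n = n⁻²` = END-ii) of the record's theorem of the same name without the `S`: **ROAD BF-x, MEAN GRADING, THE DEBT END OF RECORD's SHAPE AT THE LITERAL OF RECORD `JsRowD1Pin hLc Nw`** (odd `Lc ≥ 2`): §2 with the all-scales
bound SUPPLIED from the four (E)-family S-∕W-slot rows of row G-an2-4 (`RoadEndRowPinned.exists_allScalesSeq_JsRowD1Pin_of_slots`: `hS`∕`hSall` on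
`unitS (sfStep Lc j) (smStep 3 Lc j) (SrecAt 3 Lc ρ_c Lc⁴ (−Lc⁸∕2) (2∕Lc⁴) j)`, `hW`∕`hWall` on `unitW … (WrecAt 3 Lc ρ_c Lc⁴ (−Lc⁸∕2) (2∕Lc⁴) Lc⁸ (−Lc¹²∕4) ((8Nw²)⁻¹•wsym22 Nw)
(vh₂SAn1 Lc) (mixFFAt ρ_c Lc) j)`, own rates ∕ radii; K-side discharged).  DISPLAYED DEBT OF THE MEAN LANE, BY NAME: the four (E)-rows; B1_mean; (K) `hK`+`hω`+`hlam`;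
the sockets; `hdiv`; `hrowgh`; shell rows h2s∕d2s; `hRestTot`; (U); the printed `h12`∕`h126`.  `Nw : ℕ` (Wilson table) and `N : ℝ` (slope) kept apart. -/
theorem d1Drift_BFx_total_mean_shell_JsRowD1Pin_of_prop12_of_slotsS (hodd : Odd Lc) (hL : 2 ≤ Lc) (Nw : ℕ) {Cs cS δS θS Cw cW δWr θW : ℝ}
    -- the four (E)-family S-∕W-slot rows at the pinned constants (row G-an2-4; NOT in the tree)
    (hS : ∀ j, LocStencil (unitS (sfStep Lc j) (smStep 3 Lc j)
      (SrecAt 3 Lc (toSite (ctrOff (3 + 1) Lc)) ((Lc : ℝ) ^ 4) (-((Lc : ℝ) ^ 8 / 2)) (2 / (Lc : ℝ) ^ 4) j)) Cs δS)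
    (hSall : ∀ k j, LocStencil (unitS (sfStep Lc (k + j)) (smStep 3 Lc (k + j))
        (SrecAt 3 Lc (toSite (ctrOff (3 + 1) Lc)) ((Lc : ℝ) ^ 4) (-((Lc : ℝ) ^ 8 / 2)) (2 / (Lc : ℝ) ^ 4) (k + j)) -
      unitS (sfStep Lc k) (smStep 3 Lc k)
        (SrecAt 3 Lc (toSite (ctrOff (3 + 1) Lc)) ((Lc : ℝ) ^ 4) (-((Lc : ℝ) ^ 8 / 2)) (2 / (Lc : ℝ) ^ 4) k)) (cS * θS ^ k) δS)
    (hW : ∀ j, VertexFamily₂ (unitW (sfStep Lc j) (smStep 3 Lc j)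
      (WrecAt 3 Lc (toSite (ctrOff (3 + 1) Lc)) ((Lc : ℝ) ^ 4) (-((Lc : ℝ) ^ 8 / 2)) (2 / (Lc : ℝ) ^ 4) ((Lc : ℝ) ^ 8) (-((Lc : ℝ) ^ 12 / 4))
        ((8 * (Nw : ℝ) ^ 2)⁻¹ • wsym22 Nw) (vh₂SAn1 Lc) (mixFFAt (toSite (ctrOff (3 + 1) Lc)) Lc) j)) Lc Cw δWr)
    (hWall : ∀ k j, VertexFamily₂ (unitW (sfStep Lc (k + j)) (smStep 3 Lc (k + j))
        (WrecAt 3 Lc (toSite (ctrOff (3 + 1) Lc)) ((Lc : ℝ) ^ 4) (-((Lc : ℝ) ^ 8 / 2)) (2 / (Lc : ℝ) ^ 4) ((Lc : ℝ) ^ 8) (-((Lc : ℝ) ^ 12 / 4))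
          ((8 * (Nw : ℝ) ^ 2)⁻¹ • wsym22 Nw) (vh₂SAn1 Lc) (mixFFAt (toSite (ctrOff (3 + 1) Lc)) Lc) (k + j)) -
      unitW (sfStep Lc k) (smStep 3 Lc k)
        (WrecAt 3 Lc (toSite (ctrOff (3 + 1) Lc)) ((Lc : ℝ) ^ 4) (-((Lc : ℝ) ^ 8 / 2)) (2 / (Lc : ℝ) ^ 4) ((Lc : ℝ) ^ 8) (-((Lc : ℝ) ^ 12 / 4))
          ((8 * (Nw : ℝ) ^ 2)⁻¹ • wsym22 Nw) (vh₂SAn1 Lc) (mixFFAt (toSite (ctrOff (3 + 1) Lc)) Lc) k)) Lc (cW * θW ^ k) δWr)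
    (hδS : 0 < δS) (hδWr : 0 < δWr) (hθS0 : 0 ≤ θS) (hθS1 : θS < 1) (hθW0 : 0 ≤ θW) (hθW1 : θW < 1)
    -- the road's displayed debt, verbatim from §2
    (hμν : μ ≠ ν) (hN : N ≠ 0) (ha : 0 < a) (c : ℕ → ℝ) {A₂ δ₂ : ℝ} (hD₂ : 0 ≤ D₂) (hA₂ : 0 ≤ A₂) (hδ₂ : 0 < δ₂)
    (h12 : B5.Prop12Printed (fam nOf hn1 MOf a ha)) (h126 : B5.Kernel126_127Printed (kfam nOf MOf))
    (h2s : ∀ n : ℕ, 2 ≤ n → ∀ [NeZero n], ∀ b ∈ (univ : Finset (Fin 4 → Fin n)).image resSite, ∀ r : ℕ, r + 1 ≤ n →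
      ∑ v ∈ annulus 4 r (r + 1), |(gfrz n a b (v + unitVec ν + unitVec μ) - gFree (v + unitVec ν + unitVec μ)) -
          (gfrz n a b (v + unitVec ν) - gFree (v + unitVec ν)) - (gfrz n a b (v + unitVec μ) - gFree (v + unitVec μ)) +
          (gfrz n a b v - gFree v)| ≤ D₂ / (n : ℝ))
    (d2s : ∀ n : ℕ, 2 ≤ n → ∀ [NeZero n], ∀ b ∈ (univ : Finset (Fin 4 → Fin n)).image resSite, ∀ r : ℕ, n ≤ r →
      ∑ v ∈ annulus 4 r (r + 1), |gfrz n a b (v + unitVec ν + unitVec μ) - gfrz n a b (v + unitVec ν) - gfrz n a b (v + unitVec μ) + gfrz n a b v| ≤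
        A₂ * Real.exp (-(δ₂ / n) * ((r : ℝ) + 1)) / ((r : ℝ) + 1))
    -- bridge B1 in MEAN form for the literal of record
    (hB1 : Tendsto (fun m : ℕ => ((∑ j ∈ range m, B12Beta.secondMoment (TbalOf Lc (JsRowD1Pin hodd Nw) j) μ ν) - c (Lc ^ m)) / (m : ℝ))
      atTop (𝓝 0))
    (hK : ∀ n : ℕ, 2 ≤ n → Odd n → ∀ [NeZero n], c n =
      ωgl n * B12Beta.secondMoment (TOfRed n a (SbfBal n a (cE n) (cVH n) (cΛ n) (cR n) (cK n) (cQ n))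
        (tableRed n (Wbf (cE₂ n) (cJ4 n) (cΛ₂ n) (cR₂ n) (cQ₂ n) (WE n) (WJ n) (WΛ n) (WR n) (WQ n)))) μ ν
      + ωgh n * B12Beta.secondMoment (PghQ n a (x₀ n) (cK n) (cQ n)) μ ν + ∑ u, Ru u n)
    (s : ℕ → ℝ) (hωs : ∀ n : ℕ, 2 ≤ n → ωgh n * (s n * cK n) ^ 2 = -2 * (ωgl n * cE n ^ 2))
    (hlam : ∀ n : ℕ, 2 ≤ n → ωgl n * cE n ^ 2 = 2 * N ^ 2 * (n : ℝ) ^ 8)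
    (hδW : ∀ n, 0 < δW n)
    (hE : ∀ n κ u l u', BiLoc (WE n κ u l u') u u' (CE n) (δW n)) (hJ : ∀ n κ u l u', BiLoc (WJ n κ u l u') u u' (CJ n) (δW n))
    (hΛ : ∀ n κ u l u', BiLoc (WΛ n κ u l u') u u' (CΛ n) (δW n)) (hR : ∀ n κ u l u', BiLoc (WR n κ u l u') u u' (CRt n) (δW n))
    (hQ : ∀ n κ u l u', BiLoc (WQ n κ u l u') u u' (CQ n) (δW n))
    (hEc : ∀ (n : ℕ) (κ : Fin 4) (u : Site 4) (l : Fin 4) (u' t : Site 4),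
      WE n κ (u + (n : ℤ) • t) l (u' + (n : ℤ) • t) = shiftK (-((n : ℤ) • t)) (WE n κ u l u'))
    (hJc : ∀ (n : ℕ) (κ : Fin 4) (u : Site 4) (l : Fin 4) (u' t : Site 4),
      WJ n κ (u + (n : ℤ) • t) l (u' + (n : ℤ) • t) = shiftK (-((n : ℤ) • t)) (WJ n κ u l u'))
    (hΛc : ∀ (n : ℕ) (κ : Fin 4) (u : Site 4) (l : Fin 4) (u' t : Site 4),
      WΛ n κ (u + (n : ℤ) • t) l (u' + (n : ℤ) • t) = shiftK (-((n : ℤ) • t)) (WΛ n κ u l u'))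
    (hRc : ∀ (n : ℕ) (κ : Fin 4) (u : Site 4) (l : Fin 4) (u' t : Site 4),
      WR n κ (u + (n : ℤ) • t) l (u' + (n : ℤ) • t) = shiftK (-((n : ℤ) • t)) (WR n κ u l u'))
    (hQc : ∀ (n : ℕ) (κ : Fin 4) (u : Site 4) (l : Fin 4) (u' t : Site 4),
      WQ n κ (u + (n : ℤ) • t) l (u' + (n : ℤ) • t) = shiftK (-((n : ℤ) • t)) (WQ n κ u l u'))
    (hEs : ∀ n κ u l u', WE n κ u l u' = WE n l u' κ u) (hJs : ∀ n κ u l u', WJ n κ u l u' = WJ n l u' κ u)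
    (hΛs : ∀ n κ u l u', WΛ n κ u l u' = WΛ n l u' κ u) (hRs : ∀ n κ u l u', WR n κ u l u' = WR n l u' κ u)
    (hQs : ∀ n κ u l u', WQ n κ u l u' = WQ n l u' κ u)
    (hdiv : ∀ n : ℕ, 2 ≤ n → ∀ [NeZero n], ∀ (l' : Fin 4) (u' u : Site 4), ∑ κ' : Fin 4,
      (fineHess n a (SbfBal n a (cE n) (cVH n) (cΛ n) (cR n) (cK n) (cQ n))
          (Wbf (cE₂ n) (cJ4 n) (cΛ₂ n) (cR₂ n) (cQ₂ n) (WE n) (WJ n) (WΛ n) (WR n) (WQ n)) κ' l' (u - Pi.single κ' 1) u'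
        - fineHess n a (SbfBal n a (cE n) (cVH n) (cΛ n) (cR n) (cK n) (cQ n))
          (Wbf (cE₂ n) (cJ4 n) (cΛ₂ n) (cR₂ n) (cQ₂ n) (WE n) (WJ n) (WΛ n) (WR n) (WQ n)) κ' l' u u') = 0)
    (hrowgh : ∀ n : ℕ, 2 ≤ n → ∀ [NeZero n], ∀ (κ' l' : Fin 4) (b : Site 4), HasSum (fineHessGhQ n a (x₀ n) (cK n) (cQ n) κ' l' b) 0)
    (hRestTot : ∀ n : ℕ, 2 ≤ n → ∀ [NeZero n],
      |∑ b ∈ (univ : Finset (Fin 4 → Fin n)).image resSite, ((n : ℝ) ^ 4)⁻¹ *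
        fullSum (fun w : Pt => ∑ τ ∈ (univ : Finset RestIdx).erase cornerIdx,
          restKS n a (gfrz n a b) (fun v => s n * gfrz n a b v) (cE n) (cΛ n) (cR n) (cK n) (cQ n) (cE₂ n) (cJ4 n) (cΛ₂ n) (cR₂ n) (cQ₂ n) (x₀ n)
            (WE n) (WJ n) (WΛ n) (WR n) (WQ n) (ωgl n) (ωgh n) ((n : ℝ) ^ 8) N μ ν b τ w)| ≤ CRtot)
    (hU : ∀ n : ℕ, 2 ≤ n → ∀ u, |Ru u n| ≤ CU u) :
    D1Drift Lc (JsRowD1Pin hodd Nw) N μ ν := by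
  obtain ⟨κ', θ', hθ0, hθ1, hall⟩ :=
    exists_allScalesSeq_JsRowD1Pin_of_slots hodd hL Nw hS hSall hW hWall hδS hδWr hθS0 hθS1 hθW0 hθW1 μ ν
  exact d1Drift_BFx_total_mean_shell_of_prop12S (κ := κ') (θ := θ') _ hμν hN hL hodd ha c hD₂ hA₂ hδ₂ hall hθ0 hθ1 h12 h126 h2s d2s hB1 hK s hωs
    hlam hδW hE hJ hΛ hR hQ hEc hJc hΛc hRc hQc hEs hJs hΛs hRs hQs hdiv hrowgh hRestTot hU

end Summit.QuantumFields.BalabanUV.Beta.D1BFx.RoadEndBFxTotalMeanShellS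

end
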